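import Mathlib
import HarnessLib
import Summits.ValiantsHypothesis.ValiantsHypothesis.Theorems.LacunarySymmetroidMatrixDescartesOsculationLawRecursionWitnessResultant
import Summits.ValiantsHypothesis.ValiantsHypothesis.Theorems.LacunarySymmetroidMatrixDescartesOsculationLawUniformCongruence

/-!
# ValiantsHypothesis / LacunarySymmetroid — crux `MatrixDescartes` (stmt-ValiantsHypothesis-18050, V1),
# line `Cruxes/MatrixDescartes/Lines/osculation_law.lean` («osculation-law»), stub `stub_recursion`, R6(a):
# STRUCTURAL NODE CERTIFICATES OF THE DIAGONAL WITNESS FAMILY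

The witness of record for the density of ROUTE′'s hereditary node family `N′` is val-lit-p6 g14's GENERIC DIAGONAL
family `W_l = −diag(σ_l)` (all entries positive, distinct within each letter; ✓ `…GPWitnessGeneric`, bus
l.8195/8220/8228/8242, desk RULING #286), transported along one segment with ONE shift `c` (val-lit-p7 g13 l.8194,
val-port-3 g1's frame `…GPDensityFrame`, l.8244).  This file supplies the STRUCTURAL certificates of that family —
for EVERY such `σ`, every level (the hypothesis `∀ l, S l = −diag(σ_l)` is truncation-stable), every injective support
`d` and every shift `c > 0`, `c > max_i σ_K(i)` — in the binder shapes of `OsculationRecursion.zmult_node_le'` and of the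
frame (`d₀ S₀` / `∀ Y, det Y ≠ 0 → S_K = YᵀY − c·1 → ∀ S₁ …`):
* symmetry; a square root `Y = diag(√(c − σ_K(i)))`, `det Y ≠ 0`, `S_K = YᵀY − c·1` (the split exists);
* full pencil — `det ≢ 0`, no positive roots;
* node 1 (`−G`, support `d₀`) — (D1) `det ≢ 0` and (D2) the RESULTANT CERTIFICATE `Res_b(toBiv Φ₀, toBiv H(Φ₀)) ≠ 0`
  in val-lit-p5 g12's currency (`toBiv = MvPolynomial.aeval ![C X, X]`, ✓ `…UniformDictionary`/`…UniformGeneric`);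
* node 2, FOR EVERY square root `Y` (`det Y ≠ 0`, `YᵀY = S_K + c·1`) and `S₁ = Y⁻ᵀ(−diag σ_0, …, −diag σ_{K−1}, −c·1)Y⁻¹`
  — the same two ((D1) by `…RecursionInvariance.det_pencil_congr`; (D2) by p5's `insertionPoly_inv_congr`: all these
  pencils are nonzero constant multiples of ONE `Y`-free curve, and `resultant_toBiv_C_mul_ne_zero`).
Mechanism (`…RecursionWitnessDiagonal`, `…RecursionWitnessResultant`, `…RecursionWitnessCurve`): for the diagonal
square root the node curves are `Φ = Π_i (b − β_i(t))` with one-sign fewnomial branches `β_i = −g_i` resp.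
`(g_i + c t^N)/(c − σ_K(i))`, `g_i(t) = Σ_{l<K} σ_l(i) t^{d_l}`; each branch is strictly log-convex, and at an abscissa
`t₀ > 0` where the (generally CROSSING) branches are pairwise distinct the fibre splits with simple roots none of which
is a root of `H(Φ)(t₀, ·)` — whence `Res ≠ 0` by p5's `OsculationUniform.resultant_ne_zero_of_fibre'`.  Crossings are
osculation points: the osculation sets of this family are finite, in general NOT empty.
Honest framing: helper lemmas toward the OPEN stub `stub_recursion` (its general-position residue); the osculation
LAW, `MatrixDescartes`, Conjecture B and `VP ≠ VNP` are NOT proved.  No definitions, no named facts.  (val-lit-p4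
g13, helper `--supports stmt-ValiantsHypothesis-18050`.)
-/

-- `Summit.ValiantsHypothesis.ValiantsHypothesis.…` is the tree's mandated single-conjunct layout (Sub = Summit).
set_option linter.dupNamespace false

noncomputable section

namespace Summit.ValiantsHypothesis.ValiantsHypothesis.Theorems.LacunarySymmetroidMatrixDescartes

open Polynomial Set
open MvPolynomial (pderiv)
open scoped BigOperators Matrix

namespace OsculationRecursion

/-- **Structural node certificates of the generic diagonal witness family** `S_l = −diag(σ_l)`.  See the module
docstring. [folklore] -/
theorem node_certificates (m K : ℕ) (hK : 2 ≤ K) (d : Fin (K + 1) → ℕ) (hd : Function.Injective d)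
    (σ : Fin (K + 1) → (Fin m ⊕ Fin 0) → ℝ) (hσ : ∀ l i, 0 < σ l i) (hσi : ∀ l i j, i ≠ j → σ l i ≠ σ l j)
    (S : Fin (K + 1) → Matrix (Fin m ⊕ Fin 0) (Fin m ⊕ Fin 0) ℝ) (hS : ∀ l, S l = -Matrix.diagonal (σ l))
    (c : ℝ) (hc0 : 0 < c) (hc : ∀ i, σ (Fin.last K) i < c) :
    (∀ l, (S l).IsSymm) ∧
    (∃ Y : Matrix (Fin m ⊕ Fin 0) (Fin m ⊕ Fin 0) ℝ,
      Y.det ≠ 0 ∧ S (Fin.last K) = Yᵀ * Y - c • (1 : Matrix (Fin m ⊕ Fin 0) (Fin m ⊕ Fin 0) ℝ)) ∧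
    (∑ l, (X : ℝ[X]) ^ d l • (S l).map Polynomial.C).det ≠ 0 ∧
    (∑ l, (X : ℝ[X]) ^ d l • (S l).map Polynomial.C).det.roots.filter (fun t => 0 < t) = 0 ∧
    ∀ (d₀ : Fin K → ℕ) (S₀ : Fin K → Matrix (Fin m ⊕ Fin 0) (Fin m ⊕ Fin 0) ℝ),
      (∀ l, d₀ l = d (Fin.castSucc l)) → (∀ l, S₀ l = -S (Fin.castSucc l)) →
      (∑ l, (X : ℝ[X]) ^ d₀ l • (S₀ l).map Polynomial.C).det ≠ 0 ∧

        Polynomial.resultant (MvPolynomial.aeval (![Polynomial.C Polynomial.X, Polynomial.X] : Fin 2 → ℝ[X][X]) (∑ l, (MvPolynomial.X (0 : Fin 2) : MvPolynomial (Fin 2) ℝ) ^ d₀ l •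
              (S₀ l).map (MvPolynomial.C : ℝ →+* MvPolynomial (Fin 2) ℝ)
            + (MvPolynomial.X (1 : Fin 2) : MvPolynomial (Fin 2) ℝ) •
              (Matrix.fromBlocks 1 0 0 0 : Matrix (Fin m ⊕ Fin 0) (Fin m ⊕ Fin 0) ℝ).map
                (MvPolynomial.C : ℝ →+* MvPolynomial (Fin 2) ℝ)).det)
          (MvPolynomial.aeval (![Polynomial.C Polynomial.X, Polynomial.X] : Fin 2 → ℝ[X][X])
            (MvPolynomial.X 0 * MvPolynomial.pderiv 0 (MvPolynomial.X 0 * MvPolynomial.pderiv 0 (∑ l, (MvPolynomial.X (0 : Fin 2) : MvPolynomial (Fin 2) ℝ) ^ d₀ l •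
              (S₀ l).map (MvPolynomial.C : ℝ →+* MvPolynomial (Fin 2) ℝ)
            + (MvPolynomial.X (1 : Fin 2) : MvPolynomial (Fin 2) ℝ) •
              (Matrix.fromBlocks 1 0 0 0 : Matrix (Fin m ⊕ Fin 0) (Fin m ⊕ Fin 0) ℝ).map
                (MvPolynomial.C : ℝ →+* MvPolynomial (Fin 2) ℝ)).det)
                * (MvPolynomial.X 1 * MvPolynomial.pderiv 1 (∑ l, (MvPolynomial.X (0 : Fin 2) : MvPolynomial (Fin 2) ℝ) ^ d₀ l •
              (S₀ l).map (MvPolynomial.C : ℝ →+* MvPolynomial (Fin 2) ℝ)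
            + (MvPolynomial.X (1 : Fin 2) : MvPolynomial (Fin 2) ℝ) •
              (Matrix.fromBlocks 1 0 0 0 : Matrix (Fin m ⊕ Fin 0) (Fin m ⊕ Fin 0) ℝ).map
                (MvPolynomial.C : ℝ →+* MvPolynomial (Fin 2) ℝ)).det) ^ 2
              - 2 * (MvPolynomial.X 0 * MvPolynomial.pderiv 0 (MvPolynomial.X 1 * MvPolynomial.pderiv 1 (∑ l, (MvPolynomial.X (0 : Fin 2) : MvPolynomial (Fin 2) ℝ) ^ d₀ l •
              (S₀ l).map (MvPolynomial.C : ℝ →+* MvPolynomial (Fin 2) ℝ)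
            + (MvPolynomial.X (1 : Fin 2) : MvPolynomial (Fin 2) ℝ) •
              (Matrix.fromBlocks 1 0 0 0 : Matrix (Fin m ⊕ Fin 0) (Fin m ⊕ Fin 0) ℝ).map
                (MvPolynomial.C : ℝ →+* MvPolynomial (Fin 2) ℝ)).det))
                * (MvPolynomial.X 0 * MvPolynomial.pderiv 0 (∑ l, (MvPolynomial.X (0 : Fin 2) : MvPolynomial (Fin 2) ℝ) ^ d₀ l •
              (S₀ l).map (MvPolynomial.C : ℝ →+* MvPolynomial (Fin 2) ℝ)
            + (MvPolynomial.X (1 : Fin 2) : MvPolynomial (Fin 2) ℝ) •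
              (Matrix.fromBlocks 1 0 0 0 : Matrix (Fin m ⊕ Fin 0) (Fin m ⊕ Fin 0) ℝ).map
                (MvPolynomial.C : ℝ →+* MvPolynomial (Fin 2) ℝ)).det)
                * (MvPolynomial.X 1 * MvPolynomial.pderiv 1 (∑ l, (MvPolynomial.X (0 : Fin 2) : MvPolynomial (Fin 2) ℝ) ^ d₀ l •
              (S₀ l).map (MvPolynomial.C : ℝ →+* MvPolynomial (Fin 2) ℝ)
            + (MvPolynomial.X (1 : Fin 2) : MvPolynomial (Fin 2) ℝ) •
              (Matrix.fromBlocks 1 0 0 0 : Matrix (Fin m ⊕ Fin 0) (Fin m ⊕ Fin 0) ℝ).map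
                (MvPolynomial.C : ℝ →+* MvPolynomial (Fin 2) ℝ)).det)
              + MvPolynomial.X 1 * MvPolynomial.pderiv 1 (MvPolynomial.X 1 * MvPolynomial.pderiv 1 (∑ l, (MvPolynomial.X (0 : Fin 2) : MvPolynomial (Fin 2) ℝ) ^ d₀ l •
              (S₀ l).map (MvPolynomial.C : ℝ →+* MvPolynomial (Fin 2) ℝ)
            + (MvPolynomial.X (1 : Fin 2) : MvPolynomial (Fin 2) ℝ) •
              (Matrix.fromBlocks 1 0 0 0 : Matrix (Fin m ⊕ Fin 0) (Fin m ⊕ Fin 0) ℝ).map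
                (MvPolynomial.C : ℝ →+* MvPolynomial (Fin 2) ℝ)).det)
                * (MvPolynomial.X 0 * MvPolynomial.pderiv 0 (∑ l, (MvPolynomial.X (0 : Fin 2) : MvPolynomial (Fin 2) ℝ) ^ d₀ l •
              (S₀ l).map (MvPolynomial.C : ℝ →+* MvPolynomial (Fin 2) ℝ)
            + (MvPolynomial.X (1 : Fin 2) : MvPolynomial (Fin 2) ℝ) •
              (Matrix.fromBlocks 1 0 0 0 : Matrix (Fin m ⊕ Fin 0) (Fin m ⊕ Fin 0) ℝ).map
                (MvPolynomial.C : ℝ →+* MvPolynomial (Fin 2) ℝ)).det) ^ 2)) ≠ 0 ∧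
      ∀ (Y : Matrix (Fin m ⊕ Fin 0) (Fin m ⊕ Fin 0) ℝ), Y.det ≠ 0 →
        S (Fin.last K) = Yᵀ * Y - c • (1 : Matrix (Fin m ⊕ Fin 0) (Fin m ⊕ Fin 0) ℝ) →
      ∀ (S₁ : Fin (K + 1) → Matrix (Fin m ⊕ Fin 0) (Fin m ⊕ Fin 0) ℝ),
        (∀ l, S₁ l = (Y⁻¹)ᵀ * (Fin.snoc (fun l => S (Fin.castSucc l))
          (-(c • (1 : Matrix (Fin m ⊕ Fin 0) (Fin m ⊕ Fin 0) ℝ))) :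
            Fin (K + 1) → Matrix (Fin m ⊕ Fin 0) (Fin m ⊕ Fin 0) ℝ) l * Y⁻¹) →
        (∑ l, (X : ℝ[X]) ^ d l • (S₁ l).map Polynomial.C).det ≠ 0 ∧
        Polynomial.resultant (MvPolynomial.aeval (![Polynomial.C Polynomial.X, Polynomial.X] : Fin 2 → ℝ[X][X]) (∑ l, (MvPolynomial.X (0 : Fin 2) : MvPolynomial (Fin 2) ℝ) ^ d l •
              (S₁ l).map (MvPolynomial.C : ℝ →+* MvPolynomial (Fin 2) ℝ)
            + (MvPolynomial.X (1 : Fin 2) : MvPolynomial (Fin 2) ℝ) •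
              (Matrix.fromBlocks 1 0 0 0 : Matrix (Fin m ⊕ Fin 0) (Fin m ⊕ Fin 0) ℝ).map
                (MvPolynomial.C : ℝ →+* MvPolynomial (Fin 2) ℝ)).det)
          (MvPolynomial.aeval (![Polynomial.C Polynomial.X, Polynomial.X] : Fin 2 → ℝ[X][X])
            (MvPolynomial.X 0 * MvPolynomial.pderiv 0 (MvPolynomial.X 0 * MvPolynomial.pderiv 0 (∑ l, (MvPolynomial.X (0 : Fin 2) : MvPolynomial (Fin 2) ℝ) ^ d l •
              (S₁ l).map (MvPolynomial.C : ℝ →+* MvPolynomial (Fin 2) ℝ)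
            + (MvPolynomial.X (1 : Fin 2) : MvPolynomial (Fin 2) ℝ) •
              (Matrix.fromBlocks 1 0 0 0 : Matrix (Fin m ⊕ Fin 0) (Fin m ⊕ Fin 0) ℝ).map
                (MvPolynomial.C : ℝ →+* MvPolynomial (Fin 2) ℝ)).det)
                * (MvPolynomial.X 1 * MvPolynomial.pderiv 1 (∑ l, (MvPolynomial.X (0 : Fin 2) : MvPolynomial (Fin 2) ℝ) ^ d l •
              (S₁ l).map (MvPolynomial.C : ℝ →+* MvPolynomial (Fin 2) ℝ)
            + (MvPolynomial.X (1 : Fin 2) : MvPolynomial (Fin 2) ℝ) •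
              (Matrix.fromBlocks 1 0 0 0 : Matrix (Fin m ⊕ Fin 0) (Fin m ⊕ Fin 0) ℝ).map
                (MvPolynomial.C : ℝ →+* MvPolynomial (Fin 2) ℝ)).det) ^ 2
              - 2 * (MvPolynomial.X 0 * MvPolynomial.pderiv 0 (MvPolynomial.X 1 * MvPolynomial.pderiv 1 (∑ l, (MvPolynomial.X (0 : Fin 2) : MvPolynomial (Fin 2) ℝ) ^ d l •
              (S₁ l).map (MvPolynomial.C : ℝ →+* MvPolynomial (Fin 2) ℝ)
            + (MvPolynomial.X (1 : Fin 2) : MvPolynomial (Fin 2) ℝ) •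
              (Matrix.fromBlocks 1 0 0 0 : Matrix (Fin m ⊕ Fin 0) (Fin m ⊕ Fin 0) ℝ).map
                (MvPolynomial.C : ℝ →+* MvPolynomial (Fin 2) ℝ)).det))
                * (MvPolynomial.X 0 * MvPolynomial.pderiv 0 (∑ l, (MvPolynomial.X (0 : Fin 2) : MvPolynomial (Fin 2) ℝ) ^ d l •
              (S₁ l).map (MvPolynomial.C : ℝ →+* MvPolynomial (Fin 2) ℝ)
            + (MvPolynomial.X (1 : Fin 2) : MvPolynomial (Fin 2) ℝ) •
              (Matrix.fromBlocks 1 0 0 0 : Matrix (Fin m ⊕ Fin 0) (Fin m ⊕ Fin 0) ℝ).map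
                (MvPolynomial.C : ℝ →+* MvPolynomial (Fin 2) ℝ)).det)
                * (MvPolynomial.X 1 * MvPolynomial.pderiv 1 (∑ l, (MvPolynomial.X (0 : Fin 2) : MvPolynomial (Fin 2) ℝ) ^ d l •
              (S₁ l).map (MvPolynomial.C : ℝ →+* MvPolynomial (Fin 2) ℝ)
            + (MvPolynomial.X (1 : Fin 2) : MvPolynomial (Fin 2) ℝ) •
              (Matrix.fromBlocks 1 0 0 0 : Matrix (Fin m ⊕ Fin 0) (Fin m ⊕ Fin 0) ℝ).map
                (MvPolynomial.C : ℝ →+* MvPolynomial (Fin 2) ℝ)).det)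
              + MvPolynomial.X 1 * MvPolynomial.pderiv 1 (MvPolynomial.X 1 * MvPolynomial.pderiv 1 (∑ l, (MvPolynomial.X (0 : Fin 2) : MvPolynomial (Fin 2) ℝ) ^ d l •
              (S₁ l).map (MvPolynomial.C : ℝ →+* MvPolynomial (Fin 2) ℝ)
            + (MvPolynomial.X (1 : Fin 2) : MvPolynomial (Fin 2) ℝ) •
              (Matrix.fromBlocks 1 0 0 0 : Matrix (Fin m ⊕ Fin 0) (Fin m ⊕ Fin 0) ℝ).map
                (MvPolynomial.C : ℝ →+* MvPolynomial (Fin 2) ℝ)).det)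
                * (MvPolynomial.X 0 * MvPolynomial.pderiv 0 (∑ l, (MvPolynomial.X (0 : Fin 2) : MvPolynomial (Fin 2) ℝ) ^ d l •
              (S₁ l).map (MvPolynomial.C : ℝ →+* MvPolynomial (Fin 2) ℝ)
            + (MvPolynomial.X (1 : Fin 2) : MvPolynomial (Fin 2) ℝ) •
              (Matrix.fromBlocks 1 0 0 0 : Matrix (Fin m ⊕ Fin 0) (Fin m ⊕ Fin 0) ℝ).map
                (MvPolynomial.C : ℝ →+* MvPolynomial (Fin 2) ℝ)).det) ^ 2)) ≠ 0 := by
  classical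
  obtain ⟨K', rfl⟩ : ∃ K', K = K' + 2 := ⟨K - 2, by omega⟩
  have hSl : ∀ l, S l = Matrix.diagonal fun i => -σ l i := fun l => by rw [hS l, Matrix.diagonal_neg]
  -- exponent bookkeeping
  have h01 : (0 : Fin (K' + 2)) ≠ 1 := fun h => by
    have h' := congrArg Fin.val h
    simp only [Fin.val_zero, Fin.val_one] at h'
    omega
  have he01 : d (Fin.castSucc (0 : Fin (K' + 2))) ≠ d (Fin.castSucc 1) :=
    fun h => h01 (Fin.castSucc_injective _ (hd h))
  have he02 : d (Fin.castSucc (0 : Fin (K' + 2))) ≠ d (Fin.last (K' + 2)) :=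
    fun h => (ne_of_lt (Fin.castSucc_lt_last 0)) (hd h)
  -- the diagonal square root at the last letter: `Yd = diag √(c − σ_K(i))`
  set w : Fin m ⊕ Fin 0 → ℝ := σ (Fin.last (K' + 2)) with hw
  have hwc : ∀ i, 0 < c - w i := fun i => sub_pos.2 (hc i)
  set Yd : Matrix (Fin m ⊕ Fin 0) (Fin m ⊕ Fin 0) ℝ := Matrix.diagonal fun i => Real.sqrt (c - w i) with hYd
  have hsq : ∀ i, Real.sqrt (c - w i) * Real.sqrt (c - w i) = c - w i := fun i => Real.mul_self_sqrt (hwc i).le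
  have hsqne : ∀ i, Real.sqrt (c - w i) ≠ 0 := fun i => (Real.sqrt_pos.2 (hwc i)).ne'
  have hYdinv : Yd⁻¹ = Matrix.diagonal fun i => (Real.sqrt (c - w i))⁻¹ := by
    refine Matrix.inv_eq_left_inv ?_
    rw [hYd, Matrix.diagonal_mul_diagonal, ← Matrix.diagonal_one]
    exact congrArg Matrix.diagonal (funext fun i => inv_mul_cancel₀ (hsqne i))
  have hYddet : Yd.det ≠ 0 := by
    rw [hYd, Matrix.det_diagonal]
    exact Finset.prod_ne_zero_iff.2 fun i _ => hsqne i
  have hYdsplit : S (Fin.last (K' + 2)) = Ydᵀ * Yd - c • (1 : Matrix (Fin m ⊕ Fin 0) (Fin m ⊕ Fin 0) ℝ) := by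
    rw [hSl, hYd, Matrix.diagonal_transpose, Matrix.diagonal_mul_diagonal, Matrix.smul_one_eq_diagonal,
      Matrix.diagonal_sub]
    exact congrArg Matrix.diagonal (funext fun i => by rw [hsq i, hw]; ring)
  refine ⟨fun l => by rw [hSl l]; exact Matrix.isSymm_diagonal _, ⟨Yd, hYddet, hYdsplit⟩, ?_, ?_, ?_⟩
  · -- full pencil: `det ≢ 0` (rows `σ_l(i) > 0`)
    exact det_pencil_diagonal_ne_zero d (fun i l => σ l i)
      (fun i => ⟨0, Or.inl ⟨fun l => (hσ l i).le, hσ 0 i⟩⟩) S hSl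
  · -- full pencil: no positive roots
    exact posRoots_det_pencil_diagonal_eq_zero d (fun i l => σ l i)
      (fun i => ⟨0, Or.inl ⟨fun l => (hσ l i).le, hσ 0 i⟩⟩) S hSl
  -- node 1: `S₀ l = diag σ_l`, rows `−σ_l(i)` (negative), exponents `d₀`, branches `−g_i(t)`
  intro d₀ S₀ hd₀ hS₀
  have hd₀inj : Function.Injective d₀ := by
    intro l l' h; rw [hd₀, hd₀] at h; exact Fin.castSucc_injective _ (hd h)
  have hS₀' : ∀ l, S₀ l = Matrix.diagonal fun i => -(-σ (Fin.castSucc l) i) := fun l => by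
    rw [hS₀ l, hSl, Matrix.diagonal_neg]
  have hsign₀ : ∀ i, ∃ l₁ l₂ : Fin (K' + 2), d₀ l₁ ≠ d₀ l₂ ∧
      (((∀ l, 0 ≤ -σ (Fin.castSucc l) i) ∧ 0 < -σ (Fin.castSucc l₁) i ∧ 0 < -σ (Fin.castSucc l₂) i) ∨
       ((∀ l, -σ (Fin.castSucc l) i ≤ 0) ∧ -σ (Fin.castSucc l₁) i < 0 ∧ -σ (Fin.castSucc l₂) i < 0)) :=
    fun i => ⟨0, 1, by rw [hd₀, hd₀]; exact he01,
      Or.inr ⟨fun l => (neg_lt_zero.2 (hσ _ i)).le, neg_lt_zero.2 (hσ _ i), neg_lt_zero.2 (hσ _ i)⟩⟩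
  have hA₀ : ∀ i j, i ≠ j → ∃ l : Fin (K' + 2), -σ (Fin.castSucc l) i ≠ -σ (Fin.castSucc l) j :=
    fun i j hij => ⟨0, fun h => hσi _ i j hij (neg_injective h)⟩
  refine ⟨det_pencil_diagonal_ne_zero d₀ (fun i l => -σ (Fin.castSucc l) i)
      (fun i => ⟨0, Or.inr ⟨fun l => (neg_lt_zero.2 (hσ _ i)).le, neg_lt_zero.2 (hσ _ i)⟩⟩) S₀ hS₀',
    resultant_toBiv_ne_zero_of_diagonal' m d₀ hd₀inj (fun i l => -σ (Fin.castSucc l) i) hA₀ S₀ hS₀' _ rfl hsign₀,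
    ?_⟩
  -- node 2, for an ARBITRARY square root `Y`
  intro Y hY hsplit S₁ hS₁
  -- the snoc'ed letters `T = (S_0, …, S_{K−1}, −c·1)` are diagonal with positive rows `a⁰_{i,·} = (σ_0(i), …, c)`
  set T : Fin (K' + 2 + 1) → Matrix (Fin m ⊕ Fin 0) (Fin m ⊕ Fin 0) ℝ :=
    Fin.snoc (fun l => S (Fin.castSucc l)) (-(c • (1 : Matrix (Fin m ⊕ Fin 0) (Fin m ⊕ Fin 0) ℝ))) with hTdef
  set a₀ : (Fin m ⊕ Fin 0) → Fin (K' + 2 + 1) → ℝ := fun i l =>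
    (Fin.snoc (fun l' : Fin (K' + 2) => σ (Fin.castSucc l') i) c : Fin (K' + 2 + 1) → ℝ) l with ha₀
  have ha₀_cs : ∀ i (l' : Fin (K' + 2)), a₀ i (Fin.castSucc l') = σ (Fin.castSucc l') i := fun i l' => by
    simp only [ha₀, Fin.snoc_castSucc]
  have ha₀_last : ∀ i, a₀ i (Fin.last (K' + 2)) = c := fun i => by simp only [ha₀, Fin.snoc_last]
  have ha₀pos : ∀ i l, 0 < a₀ i l := fun i l => by
    refine Fin.lastCases ?_ (fun l' => ?_) l
    · rw [ha₀_last]; exact hc0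
    · rw [ha₀_cs]; exact hσ _ i
  have hT : ∀ l, T l = Matrix.diagonal fun i => -a₀ i l := fun l => by
    refine Fin.lastCases ?_ (fun l' => ?_) l
    · simp only [hTdef, Fin.snoc_last, ha₀_last]; rw [Matrix.smul_one_eq_diagonal, Matrix.diagonal_neg]
    · simp only [hTdef, Fin.snoc_castSucc, ha₀_cs, hSl]
  -- (D1) at node 2: congruence-invariant
  have hYinvdet : (Y⁻¹).det ≠ 0 :=
    Matrix.det_ne_zero_of_left_inverse (Matrix.mul_nonsing_inv Y (isUnit_iff_ne_zero.2 hY))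
  have hp₁ : (∑ l, (X : ℝ[X]) ^ d l • (S₁ l).map Polynomial.C) =
      ∑ l, (X : ℝ[X]) ^ d l • ((Y⁻¹)ᵀ * T l * Y⁻¹).map Polynomial.C :=
    Finset.sum_congr rfl fun l _ => by rw [hS₁ l]
  have hdet₁ : (∑ l, (X : ℝ[X]) ^ d l • (S₁ l).map Polynomial.C).det ≠ 0 := by
    rw [hp₁, det_pencil_congr]
    exact mul_ne_zero (Polynomial.C_ne_zero.2 (pow_ne_zero 2 hYinvdet))
      (det_pencil_diagonal_ne_zero d a₀ (fun i => ⟨0, Or.inl ⟨fun l => (ha₀pos i l).le, ha₀pos i 0⟩⟩) T hT)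
  refine ⟨hdet₁, ?_⟩
  -- (D2) at node 2 for the DIAGONAL square root: letters `Yd⁻ᵀ T Yd⁻¹ = diag(−a_{i,l})`, `a = a⁰/(c − σ_K(i))`
  set a : (Fin m ⊕ Fin 0) → Fin (K' + 2 + 1) → ℝ := fun i l => (c - w i)⁻¹ * a₀ i l with ha
  have hapos : ∀ i l, 0 < a i l := fun i l => mul_pos (inv_pos.2 (hwc i)) (ha₀pos i l)
  have hS₁d : ∀ l, (fun l => (Yd⁻¹)ᵀ * T l * Yd⁻¹) l = Matrix.diagonal fun i => -a i l := fun l => by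
    simp only [hYdinv, Matrix.diagonal_transpose, hT, Matrix.diagonal_mul_diagonal, ha]
    refine congrArg Matrix.diagonal (funext fun i => ?_)
    have h3 : (Real.sqrt (c - w i))⁻¹ * (Real.sqrt (c - w i))⁻¹ = (c - w i)⁻¹ := by
      rw [← mul_inv, hsq i]
    rw [← h3]; ring
  have hsign₁ : ∀ i, ∃ l₁ l₂ : Fin (K' + 2 + 1), d l₁ ≠ d l₂ ∧
      (((∀ l, 0 ≤ a i l) ∧ 0 < a i l₁ ∧ 0 < a i l₂) ∨ ((∀ l, a i l ≤ 0) ∧ a i l₁ < 0 ∧ a i l₂ < 0)) :=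
    fun i => ⟨Fin.castSucc 0, Fin.last (K' + 2), he02,
      Or.inl ⟨fun l => (hapos i l).le, hapos i _, hapos i _⟩⟩
  have hA₁ : ∀ i j, i ≠ j → ∃ l : Fin (K' + 2 + 1), a i l ≠ a j l := by
    intro i j hij
    refine ⟨Fin.last (K' + 2), fun h => ?_⟩
    simp only [ha, ha₀_last] at h
    have h2 : (c - w i)⁻¹ = (c - w j)⁻¹ := mul_right_cancel₀ hc0.ne' h
    have h3 : c - w i = c - w j := inv_injective h2
    exact hσi _ i j hij (by rw [hw] at h3; linarith)
  have hres_d := resultant_toBiv_ne_zero_of_diagonal' m d hd a hA₁ (fun l => (Yd⁻¹)ᵀ * T l * Yd⁻¹) hS₁d _ rfl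
    hsign₁
  -- transport from `Yd` to `Y`: both node-2 curves are constant multiples of the same `Y`-free curve
  have hmv₁ : (∑ l, (MvPolynomial.X (0 : Fin 2) : MvPolynomial (Fin 2) ℝ) ^ d l •
              (S₁ l).map (MvPolynomial.C : ℝ →+* MvPolynomial (Fin 2) ℝ)
            + (MvPolynomial.X (1 : Fin 2) : MvPolynomial (Fin 2) ℝ) •
              (Matrix.fromBlocks 1 0 0 0 : Matrix (Fin m ⊕ Fin 0) (Fin m ⊕ Fin 0) ℝ).map
                (MvPolynomial.C : ℝ →+* MvPolynomial (Fin 2) ℝ)).det =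
      (∑ l, (MvPolynomial.X (0 : Fin 2) : MvPolynomial (Fin 2) ℝ) ^ d l •
              ((Y⁻¹)ᵀ * T l * Y⁻¹).map (MvPolynomial.C : ℝ →+* MvPolynomial (Fin 2) ℝ)
            + (MvPolynomial.X (1 : Fin 2) : MvPolynomial (Fin 2) ℝ) •
              (Matrix.fromBlocks 1 0 0 0 : Matrix (Fin m ⊕ Fin 0) (Fin m ⊕ Fin 0) ℝ).map
                (MvPolynomial.C : ℝ →+* MvPolynomial (Fin 2) ℝ)).det := by
    rw [Finset.sum_congr rfl fun l _ => by rw [hS₁ l]]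
  have hYY : Yᵀ * Y = Ydᵀ * Yd := by
    have h1 : Yᵀ * Y = S (Fin.last (K' + 2)) + c • (1 : Matrix (Fin m ⊕ Fin 0) (Fin m ⊕ Fin 0) ℝ) := by
      rw [hsplit, sub_add_cancel]
    rw [h1, hYdsplit, sub_add_cancel]
  have heYd : (Yd.det)⁻¹ ^ 2 ≠ 0 := pow_ne_zero 2 (inv_ne_zero hYddet)
  have hmodel : (∑ l, (MvPolynomial.X (0 : Fin 2) : MvPolynomial (Fin 2) ℝ) ^ d l •
              (T l).map (MvPolynomial.C : ℝ →+* MvPolynomial (Fin 2) ℝ)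
            + (MvPolynomial.X (1 : Fin 2) : MvPolynomial (Fin 2) ℝ) •
              (Ydᵀ * Yd).map (MvPolynomial.C : ℝ →+* MvPolynomial (Fin 2) ℝ)).det =
      MvPolynomial.C (((Yd.det)⁻¹ ^ 2)⁻¹) *
        (∑ l, (MvPolynomial.X (0 : Fin 2) : MvPolynomial (Fin 2) ℝ) ^ d l •
              ((fun l => (Yd⁻¹)ᵀ * T l * Yd⁻¹) l).map (MvPolynomial.C : ℝ →+* MvPolynomial (Fin 2) ℝ)
            + (MvPolynomial.X (1 : Fin 2) : MvPolynomial (Fin 2) ℝ) •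
              (Matrix.fromBlocks 1 0 0 0 : Matrix (Fin m ⊕ Fin 0) (Fin m ⊕ Fin 0) ℝ).map
                (MvPolynomial.C : ℝ →+* MvPolynomial (Fin 2) ℝ)).det := by
    rw [OsculationUniform.insertionPoly_inv_congr m Yd hYddet d T, ← mul_assoc, ← map_mul,
      inv_mul_cancel₀ heYd, map_one, one_mul]
  rw [hmv₁, OsculationUniform.insertionPoly_inv_congr m Y hY d T, hYY, hmodel, ← mul_assoc, ← map_mul]
  exact resultant_toBiv_C_mul_ne_zero _ (mul_ne_zero (pow_ne_zero 2 (inv_ne_zero hY)) (inv_ne_zero heYd)) _ hres_d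

end OsculationRecursion

end Summit.ValiantsHypothesis.ValiantsHypothesis.Theorems.LacunarySymmetroidMatrixDescartes

end
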